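import Summits.AnomalousDissipation.AnomalousDissipation.Theorems.SolenoidalFractalHomogenisationRealisedQuasiStaticCellLawSlavedPairSlot
import Summits.AnomalousDissipation.AnomalousDissipation.Theorems.SolenoidalFractalHomogenisationRealisedQuasiStaticCellLawSlavedSectorSlot
import HarnessLib

/-!
# K2R `RealisedQuasiStaticCellLaw`, line `floquet-bloch`, stub `stub_lowSectorDecay` (S1D): contraction of the
# ISOTROPIC-PAIR sector functional of the Galerkin truncation over one full slot (weak coupling, W-near regime)

Summits-side helper file (everything proved; no definitions, no named facts; `--supports stmt-AnomalousDissipation-20446`).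
Counterpart of `slavedSector_slot_contraction` (`…SlavedSectorSlot`, min-polarisation rate) in which the two slow
entries of the sector `±ℓ + nℤ³` are measured in the time-dependent joint form of `pair_slot_contraction`:
`Ψ_G(t) = β·Σ_{k ∈ freqBall N}‖α(k)‖² − 2β‖α(ℓ)‖² + 2·S_t(α(ℓ))`, `S_t(u) = a(t)|⟪ζ,u⟫|² + b(t)|⟪p₀,u⟫|² + 2Re(c(t)·conj⟪ζ,u⟫·⟪p₀,u⟫)`
(the coset of `−ℓ` carries the same energies by reality, whence the factors `2`; at `G = 1` this is the weighted sector
energy `Ψ_β` of `…SlavedSectorSlot`). Over the full slot `j` of the `p`-th period: `Ψ_G(end) ≤ max(θ_F, θ_pair)·Ψ_G(start)`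
with `θ_F = exp(−8π²κ(n/2)²τ_j)` (rest block, `restBlock_decay_fullSlot`) and
`θ_pair = exp(−2(1−ε)λ̄τ_j + (80βΛ_jτ_jg₁⁴(1+g₁²σ²)/Δ³ + 96βg₁²/(ρτ_jΛ_jΔ³))/G_min)` (`pair_slot_contraction`),
uniformly in `N` (`pairSector_slot_contraction`).
-/

set_option linter.dupNamespace false

noncomputable section

namespace Summit.AnomalousDissipation.AnomalousDissipation.Theorems.SolenoidalFractalHomogenisation.RealisedQuasiStaticCellLaw

open Set MeasureTheory Filter Topology Function Complex Matrix
open scoped InnerProductSpace ComplexConjugate Matrix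
open Literature.Analysis Literature.Analysis.FunctionSpaces Literature.Analysis.FunctionSpaces.Torus
open Literature.Analysis.FluidPDE Literature.Analysis.FluidPDE.LatticeShear
open Summit.AnomalousDissipation.AnomalousDissipation.Theorems.SolenoidalFractalHomogenisation.PermissibleCarrier

variable {k₀ : ℕ}

/-- **Isotropic-pair sector functional: contraction over a full slot (weak coupling).** See the module docstring;
hypotheses as in `slavedSector_slot_contraction` (sector `±ℓ + nℤ³`, `2|ℓ| ≤ n`, frame `ζr`, Leray directions `p_J`,
resolved segment `Wset ∋ 0, ±1`, gap `Δ`, second-order weights `σ_o, σ_i ≤ σ`) plus the weights `a, b, c` of the joint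
slow form on the slot with their co-moving derivatives and bounds `G_min ≤ G ≤ G_max`, `32G_max²g₁²Λ ≤ G_min ελ̄βΔ`,
`8g₁²/Δ + 2λ̄/Λ ≤ Δ`. -/
theorem pairSector_slot_contraction (W : LatticeWord k₀) {n : ℕ} (hn : 0 < n) {κ : ℝ} (hκ : 0 < κ)
    (ℓ : Fin 3 → ℤ) (hℓn : 2 * ‖latticeVec ℓ‖ ≤ n) {w₀ : UnitAddTorus (Fin 3) → EuclideanSpace ℝ (Fin 3)}
    (hw₀ : FunctionSpaces.Torus.MemSobolev 1 (FunctionSpaces.EuclideanSpace.complexify ∘ w₀))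
    (hdiv : FunctionSpaces.Torus.IsWeaklyDivFree w₀) (hmean : FunctionSpaces.Torus.HasZeroMean w₀)
    (hsupp : ∀ k : Fin 3 → ℤ, ¬ ((∃ z : Fin 3 → ℤ, k = ℓ + (n:ℤ) • z) ∨ (∃ z : Fin 3 → ℤ, k = -ℓ + (n:ℤ) • z)) →
      UnitAddTorus.mFourierCoeff (FunctionSpaces.EuclideanSpace.complexify ∘ w₀) k = 0)
    {N : ℕ} (hBN : (Finset.univ.biUnion fun j : Fin k₀ =>
        ({(fun i => (W.phase j).m i * n), -(fun i => (W.phase j).m i * n)} : Finset (Fin 3 → ℤ))) ⊆ freqBall N)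
    {T : ℝ} (p : ℕ) (j : Fin k₀) (hT : (p : ℝ) * W.period + W.start j + (W.phase j).τ ≤ T)
    (hk : ∀ J : ℤ, ℓ + J • (fun i => (W.phase j).m i * (n : ℤ)) ∈ freqBall N →
      ℓ + J • (fun i => (W.phase j).m i * (n : ℤ)) ≠ 0)
    (hdisj : ∀ J J' : ℤ, ℓ + J • (fun i => (W.phase j).m i * (n : ℤ)) ≠ -(ℓ + J' • (fun i => (W.phase j).m i * (n : ℤ))))
    {ζr : Fin 3 → ℝ} (hζ1 : ζr ⬝ᵥ ζr = 1) (hζ0 : ζr ⬝ᵥ (fun i => ((ℓ i : ℤ) : ℝ)) = 0)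
    (hζK : ζr ⬝ᵥ (fun i => (((fun i => (W.phase j).m i * (n : ℤ)) i : ℤ) : ℝ)) = 0)
    {pf : ℤ → Fin 3 → ℝ}
    (hp : ∀ J : ℤ, pf J = (Real.sqrt ((fun i => (((ℓ + J • (fun i => (W.phase j).m i * (n : ℤ))) i : ℤ) : ℝ)) ⬝ᵥ
        (fun i => (((ℓ + J • (fun i => (W.phase j).m i * (n : ℤ))) i : ℤ) : ℝ))))⁻¹ •
        (fun i => (((ℓ + J • (fun i => (W.phase j).m i * (n : ℤ))) i : ℤ) : ℝ)) ⨯₃ ζr)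
    {Wset : Finset ℤ} (hW : ∀ J : ℤ, J ∈ Wset ↔ ℓ + J • (fun i => (W.phase j).m i * (n : ℤ)) ∈ freqBall N)
    (h0 : (0 : ℤ) ∈ Wset) (h1 : (1 : ℤ) ∈ Wset) (hm1 : (-1 : ℤ) ∈ Wset)
    (hs : ∀ J ∈ Wset, |pf J ⬝ᵥ pf (J + 1)| ≤ 1)
    (Λ Δ ε β σo σi σ lam Gmax Gmin g₁ : ℝ) (wa wb : ℝ → ℝ) (wc : ℝ → ℂ)
    (hΛ : Λ = κ * (4 * Real.pi ^ 2 * freqNormSq (fun i => (W.phase j).m i * (n : ℤ))))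
    (hΔ0 : 0 < Δ) (hε : 0 ≤ ε) (hβ : 0 ≤ β) (hlam : 0 ≤ lam) (hGmin : 0 < Gmin)
    (hgap : ∀ J ∈ Wset, J ≠ 0 →
      freqNormSq ℓ / freqNormSq (fun i => (W.phase j).m i * (n : ℤ)) + Δ ≤
        freqNormSq (ℓ + J • (fun i => (W.phase j).m i * (n : ℤ))) / freqNormSq (fun i => (W.phase j).m i * (n : ℤ)))
    (hσo : σo = 1 / (freqNormSq (ℓ + (-1 : ℤ) • (fun i => (W.phase j).m i * (n : ℤ))) /
          freqNormSq (fun i => (W.phase j).m i * (n : ℤ)) - freqNormSq ℓ / freqNormSq (fun i => (W.phase j).m i * (n : ℤ))) +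
        1 / (freqNormSq (ℓ + (1 : ℤ) • (fun i => (W.phase j).m i * (n : ℤ))) /
          freqNormSq (fun i => (W.phase j).m i * (n : ℤ)) - freqNormSq ℓ / freqNormSq (fun i => (W.phase j).m i * (n : ℤ))))
    (hσi : σi = (pf (-1) ⬝ᵥ pf 0) ^ 2 / (freqNormSq (ℓ + (-1 : ℤ) • (fun i => (W.phase j).m i * (n : ℤ))) /
          freqNormSq (fun i => (W.phase j).m i * (n : ℤ)) - freqNormSq ℓ / freqNormSq (fun i => (W.phase j).m i * (n : ℤ))) +
        (pf 0 ⬝ᵥ pf 1) ^ 2 / (freqNormSq (ℓ + (1 : ℤ) • (fun i => (W.phase j).m i * (n : ℤ))) /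
          freqNormSq (fun i => (W.phase j).m i * (n : ℤ)) - freqNormSq ℓ / freqNormSq (fun i => (W.phase j).m i * (n : ℤ))))
    (hg₁ : g₁ = 2 * Real.pi * (∑ i, (W.phase j).e i * (ℓ i : ℝ)) *
        ‖Complex.exp ((W.phase j).φ * Complex.I) *
          (1 / (2 * ((2 * Real.pi * ‖latticeVec (W.phase j).m‖ : ℝ) : ℂ) * Complex.I))‖ * (1 / (n : ℝ)) / Λ)
    (hσole : σo ≤ σ) (hσile : σi ≤ σ)
    (hGmax : ∀ t ∈ Icc ((p : ℝ) * W.period + W.start j) ((p : ℝ) * W.period + W.start j + (W.phase j).τ), wa t ≤ Gmax ∧ wb t ≤ Gmax ∧ ‖wc t‖ ≤ Gmax)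
    (hG : ∀ t ∈ Icc ((p : ℝ) * W.period + W.start j) ((p : ℝ) * W.period + W.start j + (W.phase j).τ), ∀ y₁ y₂ : ℂ,
      Gmin * (‖y₁‖ ^ 2 + ‖y₂‖ ^ 2) ≤ wa t * ‖y₁‖ ^ 2 + wb t * ‖y₂‖ ^ 2 + 2 * (wc t * conj y₁ * y₂).re)
    (hβ' : 16 * Gmax ^ 2 * g₁ ^ 2 * Λ * 2 ≤ Gmin * ε * lam * β * Δ)
    (hsmall : g₁ ^ 2 * (4 * 2 / Δ) + 2 * lam / Λ ≤ Δ)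
    (hwa : ∀ t ∈ Icc ((p : ℝ) * W.period + W.start j) ((p : ℝ) * W.period + W.start j + (W.phase j).τ),
      HasDerivWithinAt wa ((2 * (Λ * (freqNormSq ℓ / freqNormSq (fun i => (W.phase j).m i * (n : ℤ)) +
          (g₁ * LatticeWord.trapezoid 0 (W.phase j).τ W.ramp (t - ((p : ℝ) * W.period + W.start j))) ^ 2 * σo) - lam)) *
        wa t) (Icc ((p : ℝ) * W.period + W.start j) ((p : ℝ) * W.period + W.start j + (W.phase j).τ)) t)
    (hwb : ∀ t ∈ Icc ((p : ℝ) * W.period + W.start j) ((p : ℝ) * W.period + W.start j + (W.phase j).τ),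
      HasDerivWithinAt wb ((2 * (Λ * (freqNormSq ℓ / freqNormSq (fun i => (W.phase j).m i * (n : ℤ)) +
          (g₁ * LatticeWord.trapezoid 0 (W.phase j).τ W.ramp (t - ((p : ℝ) * W.period + W.start j))) ^ 2 * σi) - lam)) *
        wb t) (Icc ((p : ℝ) * W.period + W.start j) ((p : ℝ) * W.period + W.start j + (W.phase j).τ)) t)
    (hwc : ∀ t ∈ Icc ((p : ℝ) * W.period + W.start j) ((p : ℝ) * W.period + W.start j + (W.phase j).τ),
      HasDerivWithinAt wc ((((Λ * (freqNormSq ℓ / freqNormSq (fun i => (W.phase j).m i * (n : ℤ)) +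
            (g₁ * LatticeWord.trapezoid 0 (W.phase j).τ W.ramp (t - ((p : ℝ) * W.period + W.start j))) ^ 2 * σo) +
          Λ * (freqNormSq ℓ / freqNormSq (fun i => (W.phase j).m i * (n : ℤ)) +
            (g₁ * LatticeWord.trapezoid 0 (W.phase j).τ W.ramp (t - ((p : ℝ) * W.period + W.start j))) ^ 2 * σi) -
          2 * lam : ℝ) : ℂ) * wc t))
        (Icc ((p : ℝ) * W.period + W.start j) ((p : ℝ) * W.period + W.start j + (W.phase j).τ)) t)
    (Θ : ℝ) (hΘ : max (Real.exp (-(8 * Real.pi ^ 2 * κ * ((n : ℝ) / 2) ^ 2) * (W.phase j).τ))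
        (Real.exp (-(2 * (1 - ε) * lam * (W.phase j).τ) +
          (40 * β * 2 * Λ * (W.phase j).τ * g₁ ^ 4 * (1 + g₁ ^ 2 * σ ^ 2) / Δ ^ 3 +
            48 * β * 2 * g₁ ^ 2 / (W.ramp * (W.phase j).τ * Λ * Δ ^ 3)) / Gmin)) ≤ Θ) :
    β * ∑ k ∈ freqBall N, ‖(pvSetup_cell W hn hκ.le ℓ hw₀ hdiv hmean hsupp).galerkinCoeffAt N
          ((p : ℝ) * W.period + W.start j + (W.phase j).τ) k‖ ^ 2 -
        2 * β * ‖(pvSetup_cell W hn hκ.le ℓ hw₀ hdiv hmean hsupp).galerkinCoeffAt N ((p : ℝ) * W.period + W.start j + (W.phase j).τ) ℓ‖ ^ 2 +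
        2 * (wa ((p : ℝ) * W.period + W.start j + (W.phase j).τ) * ‖inner ℂ (WithLp.toLp 2 (Complex.ofReal ∘ ζr) : EuclideanSpace ℂ (Fin 3)) ((pvSetup_cell W hn hκ.le ℓ hw₀ hdiv hmean hsupp).galerkinCoeffAt N ((p : ℝ) * W.period + W.start j + (W.phase j).τ) ℓ)‖ ^ 2 +
          wb ((p : ℝ) * W.period + W.start j + (W.phase j).τ) * ‖inner ℂ (WithLp.toLp 2 (Complex.ofReal ∘ pf 0) : EuclideanSpace ℂ (Fin 3)) ((pvSetup_cell W hn hκ.le ℓ hw₀ hdiv hmean hsupp).galerkinCoeffAt N ((p : ℝ) * W.period + W.start j + (W.phase j).τ) ℓ)‖ ^ 2 +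
          2 * (wc ((p : ℝ) * W.period + W.start j + (W.phase j).τ) * conj (inner ℂ (WithLp.toLp 2 (Complex.ofReal ∘ ζr) : EuclideanSpace ℂ (Fin 3)) ((pvSetup_cell W hn hκ.le ℓ hw₀ hdiv hmean hsupp).galerkinCoeffAt N ((p : ℝ) * W.period + W.start j + (W.phase j).τ) ℓ)) *
            inner ℂ (WithLp.toLp 2 (Complex.ofReal ∘ pf 0) : EuclideanSpace ℂ (Fin 3)) ((pvSetup_cell W hn hκ.le ℓ hw₀ hdiv hmean hsupp).galerkinCoeffAt N ((p : ℝ) * W.period + W.start j + (W.phase j).τ) ℓ)).re) ≤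
      Θ * (β * ∑ k ∈ freqBall N, ‖(pvSetup_cell W hn hκ.le ℓ hw₀ hdiv hmean hsupp).galerkinCoeffAt N
            ((p : ℝ) * W.period + W.start j) k‖ ^ 2 -
        2 * β * ‖(pvSetup_cell W hn hκ.le ℓ hw₀ hdiv hmean hsupp).galerkinCoeffAt N ((p : ℝ) * W.period + W.start j) ℓ‖ ^ 2 +
        2 * (wa ((p : ℝ) * W.period + W.start j) * ‖inner ℂ (WithLp.toLp 2 (Complex.ofReal ∘ ζr) : EuclideanSpace ℂ (Fin 3)) ((pvSetup_cell W hn hκ.le ℓ hw₀ hdiv hmean hsupp).galerkinCoeffAt N ((p : ℝ) * W.period + W.start j) ℓ)‖ ^ 2 +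
          wb ((p : ℝ) * W.period + W.start j) * ‖inner ℂ (WithLp.toLp 2 (Complex.ofReal ∘ pf 0) : EuclideanSpace ℂ (Fin 3)) ((pvSetup_cell W hn hκ.le ℓ hw₀ hdiv hmean hsupp).galerkinCoeffAt N ((p : ℝ) * W.period + W.start j) ℓ)‖ ^ 2 +
          2 * (wc ((p : ℝ) * W.period + W.start j) * conj (inner ℂ (WithLp.toLp 2 (Complex.ofReal ∘ ζr) : EuclideanSpace ℂ (Fin 3)) ((pvSetup_cell W hn hκ.le ℓ hw₀ hdiv hmean hsupp).galerkinCoeffAt N ((p : ℝ) * W.period + W.start j) ℓ)) *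
            inner ℂ (WithLp.toLp 2 (Complex.ofReal ∘ pf 0) : EuclideanSpace ℂ (Fin 3)) ((pvSetup_cell W hn hκ.le ℓ hw₀ hdiv hmean hsupp).galerkinCoeffAt N ((p : ℝ) * W.period + W.start j) ℓ)).re)) := by
  classical
  set hPV := pvSetup_cell W hn hκ.le ℓ hw₀ hdiv hmean hsupp with hPVdef
  set K : Fin 3 → ℤ := fun i => (W.phase j).m i * (n : ℤ) with hK
  set ζc : EuclideanSpace ℂ (Fin 3) := WithLp.toLp 2 (Complex.ofReal ∘ ζr) with hζc
  set pc0 : EuclideanSpace ℂ (Fin 3) := WithLp.toLp 2 (Complex.ofReal ∘ pf 0) with hpc0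
  -- complex transversality of `ζ`
  have hcast : ∀ k : Fin 3 → ℤ, ζr ⬝ᵥ (fun i => ((k i : ℤ) : ℝ)) = 0 → ∑ i, ((k i : ℤ) : ℂ) * ζc i = 0 := by
    intro k hk0
    have e : ∑ i, ((k i : ℤ) : ℂ) * ζc i = (((ζr ⬝ᵥ fun i => ((k i : ℤ) : ℝ) : ℝ)) : ℂ) := by
      rw [dotProduct]; push_cast
      refine Finset.sum_congr rfl fun i _ => ?_
      simp [hζc, mul_comm]
    rw [e, hk0]; simp
  -- the pair functional of the principal coset contracts
  have hpair := pair_slot_contraction W hn hκ ℓ hw₀ hdiv hmean hsupp hBN p j hT ℓ hk (hcast ℓ hζ0) (hcast _ hζK)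
    hζ1 hζ0 hζK hp hW h0 h1 hm1 hs Λ Δ ε β σo σi σ lam Gmax Gmin g₁ wa wb wc hΛ hΔ0 hε hβ hlam hGmin hgap hσo hσi
    hσole hσile hg₁ hGmax hG hβ' hsmall hwa hwb hwc
  obtain ⟨a, ha⟩ : ∃ a : ℝ, a = (p : ℝ) * W.period + W.start j := ⟨_, rfl⟩
  obtain ⟨b, hb⟩ : ∃ b : ℝ, b = (p : ℝ) * W.period + W.start j + (W.phase j).τ := ⟨_, rfl⟩
  have hGa := hG a (by rw [ha]; exact ⟨le_rfl, by linarith [(W.phase j).τ_pos]⟩)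
  rw [← hb, ← ha] at hpair ⊢
  -- abbreviations for the two factors and the energies
  obtain ⟨θF, hθF⟩ : ∃ θ : ℝ, θ = Real.exp (-(8 * Real.pi ^ 2 * κ * ((n : ℝ) / 2) ^ 2) * (W.phase j).τ) := ⟨_, rfl⟩
  obtain ⟨θP, hθP⟩ : ∃ θ : ℝ, θ = Real.exp (-(2 * (1 - ε) * lam * (W.phase j).τ) +
          (40 * β * 2 * Λ * (W.phase j).τ * g₁ ^ 4 * (1 + g₁ ^ 2 * σ ^ 2) / Δ ^ 3 +
            48 * β * 2 * g₁ ^ 2 / (W.ramp * (W.phase j).τ * Λ * Δ ^ 3)) / Gmin) := ⟨_, rfl⟩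
  rw [← hθP] at hpair
  rw [← hθF, ← hθP] at hΘ
  have hθF0 : 0 ≤ θF := by rw [hθF]; positivity
  have hθP0 : 0 ≤ θP := by rw [hθP]; positivity
  obtain ⟨E, hE⟩ : ∃ E : ℝ → (Fin 3 → ℤ) → ℝ, E = fun τ k => ‖hPV.galerkinCoeffAt N τ k‖ ^ 2 := ⟨_, rfl⟩
  have hE0 : ∀ τ k, 0 ≤ E τ k := fun τ k => by rw [hE]; positivity
  obtain ⟨Eo, hEo⟩ : ∃ Eo : ℝ → ℤ → ℝ, Eo = fun τ J => ‖inner ℂ ζc (hPV.galerkinCoeffAt N τ (ℓ + J • K))‖ ^ 2 :=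
    ⟨_, rfl⟩
  obtain ⟨Ei, hEi⟩ : ∃ Ei : ℝ → ℤ → ℝ, Ei = fun τ J => ‖inner ℂ (WithLp.toLp 2 (Complex.ofReal ∘ pf J) :
      EuclideanSpace ℂ (Fin 3)) (hPV.galerkinCoeffAt N τ (ℓ + J • K))‖ ^ 2 := ⟨_, rfl⟩
  obtain ⟨Sf, hSf⟩ : ∃ Sf : ℝ → ℝ, Sf = fun τ => wa τ * ‖inner ℂ ζc (hPV.galerkinCoeffAt N τ ℓ)‖ ^ 2 +
      wb τ * ‖inner ℂ pc0 (hPV.galerkinCoeffAt N τ ℓ)‖ ^ 2 +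
      2 * (wc τ * conj (inner ℂ ζc (hPV.galerkinCoeffAt N τ ℓ)) * inner ℂ pc0 (hPV.galerkinCoeffAt N τ ℓ)).re :=
    ⟨_, rfl⟩
  -- the partition of the ball
  set Pp : Finset (Fin 3 → ℤ) := Wset.image (fun J : ℤ => ℓ + J • K) with hPp
  set Pm : Finset (Fin 3 → ℤ) := Pp.image (fun k => -k) with hPm
  set U : Finset (Fin 3 → ℤ) := Pp ∪ Pm with hU
  set F : Finset (Fin 3 → ℤ) := freqBall N \ U with hF
  have hK0 : K ≠ 0 := cellFreq_ne_zero (W.phase j) hn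
  have hPpS : Pp ⊆ freqBall N := by
    intro k hk'
    obtain ⟨J, hJ, rfl⟩ := Finset.mem_image.1 hk'
    exact (hW J).1 hJ
  have hPmS : Pm ⊆ freqBall N := by
    intro k hk'
    obtain ⟨k', hk'P, rfl⟩ := Finset.mem_image.1 hk'
    exact neg_mem_freqBall_of_mem _ (hPpS hk'P)
  have hUS : U ⊆ freqBall N := Finset.union_subset hPpS hPmS
  have hPdisj : Disjoint Pp Pm := by
    rw [Finset.disjoint_left]
    intro k hkP hkM
    obtain ⟨J, _, rfl⟩ := Finset.mem_image.1 hkP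
    obtain ⟨k', hk'P, hk'eq⟩ := Finset.mem_image.1 hkM
    obtain ⟨J', _, rfl⟩ := Finset.mem_image.1 hk'P
    exact hdisj J J' hk'eq.symm
  -- sums over the pieces
  have hsplit : ∀ τ, ∑ k ∈ freqBall N, E τ k = 2 * ∑ J ∈ Wset, E τ (ℓ + J • K) + ∑ k ∈ F, E τ k := by
    intro τ
    have hPp_sum : ∑ k ∈ Pp, E τ k = ∑ J ∈ Wset, E τ (ℓ + J • K) := by
      rw [hPp, Finset.sum_image (fun J _ J' _ h => coset_injective hK0 ℓ h)]
    have hPm_sum : ∑ k ∈ Pm, E τ k = ∑ k ∈ Pp, E τ k := by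
      rw [hPm, Finset.sum_image (fun k _ k' _ h => neg_injective h)]
      refine Finset.sum_congr rfl fun k _ => ?_
      simp only [hE]
      rw [norm_galerkinCoeffAt_neg W hn hκ.le ℓ hw₀ hdiv hmean hsupp]
    rw [← Finset.sum_sdiff hUS, hU, Finset.sum_union hPdisj, hPm_sum, hPp_sum]
    ring
  -- the block split of the principal coset energies
  have hblocks : ∀ τ, ∀ J ∈ Wset, E τ (ℓ + J • K) = Eo τ J + Ei τ J := by
    intro τ J hJ
    simp only [hE, hEo, hEi]
    rw [hp J]
    exact norm_sq_galerkinCoeffAt_eq_blocks W hn hκ.le ℓ hw₀ hdiv hmean hsupp N τ j ℓ J (hk J ((hW J).1 hJ)) hζ1 hζ0 hζK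
  -- the weighted functional in slot form
  have hΨ : ∀ τ, β * ∑ k ∈ freqBall N, E τ k - 2 * β * E τ ℓ + 2 * Sf τ =
      β * ∑ k ∈ F, E τ k + 2 * (Sf τ + β * (∑ J ∈ Wset.erase 0, Eo τ J + ∑ J ∈ Wset.erase 0, Ei τ J)) := by
    intro τ
    have hℓ0 : E τ ℓ = E τ (ℓ + (0 : ℤ) • K) := by simp
    have hsumW : ∑ J ∈ Wset, E τ (ℓ + J • K) = E τ (ℓ + (0 : ℤ) • K) + ∑ J ∈ Wset.erase 0, (Eo τ J + Ei τ J) := by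
      rw [← Finset.add_sum_erase Wset _ h0, Finset.sum_congr rfl fun J hJ => hblocks τ J (Finset.mem_of_mem_erase hJ)]
    rw [hsplit τ, hℓ0, hsumW, Finset.sum_add_distrib]
    ring
  -- the rest block: structure and decay
  have hFS : F ⊆ freqBall N := Finset.sdiff_subset
  have hmemPp : ∀ J : ℤ, ℓ + J • K ∈ freqBall N → ℓ + J • K ∈ Pp := fun J hJ =>
    Finset.mem_image.2 ⟨J, (hW J).2 hJ, rfl⟩
  have hmemPm : ∀ J : ℤ, ℓ + J • K ∈ freqBall N → -(ℓ + J • K) ∈ Pm := fun J hJ =>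
    Finset.mem_image.2 ⟨ℓ + J • K, hmemPp J hJ, rfl⟩
  have hUsymm : ∀ k ∈ U, -k ∈ U := by
    intro k hk'
    rw [hU, Finset.mem_union] at hk' ⊢
    rcases hk' with h | h
    · exact Or.inr (Finset.mem_image.2 ⟨k, h, rfl⟩)
    · obtain ⟨k', hk'P, rfl⟩ := Finset.mem_image.1 h
      rw [neg_neg]; exact Or.inl hk'P
  have hFsymm : ∀ k ∈ F, -k ∈ F := by
    intro k hk'
    rw [hF, Finset.mem_sdiff] at hk' ⊢
    refine ⟨neg_mem_freqBall_of_mem _ hk'.1, fun h => hk'.2 ?_⟩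
    have := hUsymm _ h
    rwa [neg_neg] at this
  have hUadd : ∀ k, k + K ∈ U → k ∈ freqBall N → k ∈ U := by
    intro k hkU hkS
    rw [hU, Finset.mem_union] at hkU ⊢
    rcases hkU with h | h
    · obtain ⟨J, _, hJk⟩ := Finset.mem_image.1 h
      have hk' : k = ℓ + (J - 1) • K := by rw [sub_smul, one_smul, ← add_sub_assoc, hJk]; abel
      rw [hk'] at hkS ⊢
      exact Or.inl (hmemPp _ hkS)
    · obtain ⟨k', hk'P, hk'eq⟩ := Finset.mem_image.1 h
      obtain ⟨J, _, hJk⟩ := Finset.mem_image.1 hk'P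
      have hk' : k = -(ℓ + (J + 1) • K) := by
        rw [add_smul, one_smul, ← add_assoc, hJk, neg_add, hk'eq]; abel
      rw [hk'] at hkS ⊢
      have hkS' : ℓ + (J + 1) • K ∈ freqBall N := by
        have := neg_mem_freqBall_of_mem _ hkS
        rwa [neg_neg] at this
      exact Or.inr (hmemPm _ hkS')
  have hUsub : ∀ k, k - K ∈ U → k ∈ freqBall N → k ∈ U := by
    intro k hkU hkS
    have h1' : -k + K ∈ U := by
      have := hUsymm _ hkU
      rwa [neg_sub, sub_eq_neg_add] at this
    have h2 := hUadd (-k) h1' (neg_mem_freqBall_of_mem _ hkS)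
    have := hUsymm _ h2
    rwa [neg_neg] at this
  have hFadd : ∀ k ∈ F, k + K ∈ freqBall N → k + K ∈ F := by
    intro k hkF hkS
    rw [hF, Finset.mem_sdiff] at hkF ⊢
    exact ⟨hkS, fun h => hkF.2 (hUadd k h hkF.1)⟩
  have hFsub : ∀ k ∈ F, k - K ∈ freqBall N → k - K ∈ F := by
    intro k hkF hkS
    rw [hF, Finset.mem_sdiff] at hkF ⊢
    exact ⟨hkS, fun h => hkF.2 (hUsub k h hkF.1)⟩
  have hR : ∀ τ ∈ Icc a b, ∀ k ∈ F, freqNormSq k < ((n : ℝ) / 2) ^ 2 → hPV.galerkinCoeffAt N τ k = 0 := by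
    intro τ _ k hkF hlt
    by_cases hsec : k ∈ ({k | (∃ z : Fin 3 → ℤ, k = ℓ + (n:ℤ) • z) ∨ (∃ z : Fin 3 → ℤ, k = -ℓ + (n:ℤ) • z)} :
        Set (Fin 3 → ℤ))
    · exfalso
      rw [hF, Finset.mem_sdiff] at hkF
      rcases hsec with ⟨z, hz⟩ | ⟨z, hz⟩
      · by_cases hz0 : z = 0
        · subst hz0
          have hkℓ : k = ℓ + (0 : ℤ) • K := by rw [hz]; simp
          exact hkF.2 (by rw [hU, Finset.mem_union]; exact Or.inl (hkℓ ▸ hmemPp 0 (hkℓ ▸ hkF.1)))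
        · exact absurd hlt (not_lt.2 (half_le_norm_of_sector hz0 hℓn (Or.inl hz)))
      · by_cases hz0 : z = 0
        · subst hz0
          have hkℓ : k = -(ℓ + (0 : ℤ) • K) := by rw [hz]; simp
          have hℓS : ℓ + (0 : ℤ) • K ∈ freqBall N := by
            have := neg_mem_freqBall_of_mem _ hkF.1
            rwa [hkℓ, neg_neg] at this
          exact hkF.2 (by rw [hU, Finset.mem_union]; exact Or.inr (hkℓ ▸ hmemPm 0 hℓS))
        · exact absurd hlt (not_lt.2 (half_le_norm_of_sector hz0 hℓn (Or.inr hz)))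
    · exact hPV.galerkinCoeffAt_eq_zero N τ (Or.inl hsec)
  have hFdec' := restBlock_decay_fullSlot W hn hκ.le ℓ hw₀ hdiv hmean hsupp hBN p j hT hFS hFsymm hFadd hFsub
    (R := (n : ℝ) / 2) (by rw [← hb, ← ha]; exact hR)
  rw [← hb, ← ha, ← hθF] at hFdec'
  have hFdec : ∑ k ∈ F, E b k ≤ θF * ∑ k ∈ F, E a k := by rw [hE]; exact hFdec'
  have hpair' : Sf b + β * (∑ J ∈ Wset.erase 0, Eo b J + ∑ J ∈ Wset.erase 0, Ei b J) ≤
      θP * (Sf a + β * (∑ J ∈ Wset.erase 0, Eo a J + ∑ J ∈ Wset.erase 0, Ei a J)) := by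
    rw [← hpc0, ← hK] at hpair
    simp only [hSf, hEo, hEi]
    convert hpair using 3
  -- assemble
  have hEo0 : ∀ τ J, 0 ≤ Eo τ J := fun τ J => by rw [hEo]; positivity
  have hEi0 : ∀ τ J, 0 ≤ Ei τ J := fun τ J => by rw [hEi]; positivity
  have hFa0 : 0 ≤ ∑ k ∈ F, E a k := Finset.sum_nonneg fun k _ => hE0 a k
  have hSa0 : 0 ≤ Sf a := by
    have h1' := hGa (inner ℂ ζc (hPV.galerkinCoeffAt N a ℓ)) (inner ℂ pc0 (hPV.galerkinCoeffAt N a ℓ))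
    have h2' : 0 ≤ Gmin * (‖inner ℂ ζc (hPV.galerkinCoeffAt N a ℓ)‖ ^ 2 + ‖inner ℂ pc0 (hPV.galerkinCoeffAt N a ℓ)‖ ^ 2) := by
      positivity
    rw [hSf]
    linarith only [h1', h2']
  have hPa0 : 0 ≤ Sf a + β * (∑ J ∈ Wset.erase 0, Eo a J + ∑ J ∈ Wset.erase 0, Ei a J) :=
    add_nonneg hSa0 (mul_nonneg hβ (add_nonneg (Finset.sum_nonneg fun J _ => hEo0 a J)
      (Finset.sum_nonneg fun J _ => hEi0 a J)))
  have hmF : θF ≤ max θF θP := le_max_left _ _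
  have hmP : θP ≤ max θF θP := le_max_right _ _
  have hΨa0 : 0 ≤ β * ∑ k ∈ freqBall N, E a k - 2 * β * E a ℓ + 2 * Sf a := by
    rw [hΨ a]
    have : 0 ≤ β * ∑ k ∈ F, E a k := mul_nonneg hβ hFa0
    linarith only [this, hPa0]
  have hgoal : β * ∑ k ∈ freqBall N, E b k - 2 * β * E b ℓ + 2 * Sf b ≤
      max θF θP * (β * ∑ k ∈ freqBall N, E a k - 2 * β * E a ℓ + 2 * Sf a) := by
    rw [hΨ b, hΨ a]
    have t1 : β * ∑ k ∈ F, E b k ≤ max θF θP * (β * ∑ k ∈ F, E a k) := by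
      have u1 := mul_le_mul_of_nonneg_left hFdec hβ
      have u2 : β * (θF * ∑ k ∈ F, E a k) ≤ β * (max θF θP * ∑ k ∈ F, E a k) :=
        mul_le_mul_of_nonneg_left (mul_le_mul_of_nonneg_right hmF hFa0) hβ
      have e : β * (max θF θP * ∑ k ∈ F, E a k) = max θF θP * (β * ∑ k ∈ F, E a k) := by ring
      linarith only [u1, u2, e]
    have t2 := hpair'.trans (mul_le_mul_of_nonneg_right hmP hPa0)
    linarith only [t1, t2]
  have hfin := hgoal.trans (mul_le_mul_of_nonneg_right hΘ hΨa0)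
  rw [hE, hSf] at hfin
  exact hfin

end Summit.AnomalousDissipation.AnomalousDissipation.Theorems.SolenoidalFractalHomogenisation.RealisedQuasiStaticCellLaw

end
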